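import Mathlib
import Summits.MatrixMultiplication.MatrixMultiplication.Theses.FourierTwoFamiliesModP
import Summits.MatrixMultiplication.MatrixMultiplication.Theorems.PrimeTwoFamilies.Negative.Slices
import Literature.Computability.AlgebraicComplexity.SimultaneousDoubleProduct
import Summits.MatrixMultiplication.MatrixMultiplication.Theorems.FourierTwoFamiliesModPCyclicReductionTransfer

/-!
# Line `Sketch` (capacity form), crux `PrimeTwoFamilies` (stmt-MatrixMultiplication-14308) — stub `stub_capacityTransfer`

Capacity gadgets (a zero-error code over a gadget of direct pairs in `ℤ/m`) give every slice
`0 < δ ≤ 1` of the crux: code lift to `Fin L → ℤ/m`, carry-free transfer to a prime host, bookkeeping.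

* `capacityTransfer_codeLift` — the CODE LIFT: a zero-error code `W` over a gadget of direct pairs
  `(P c, Q c)` lifts to an SDPP family of `|W|` blocks `∏ₜ P (w t)`, `∏ₜ Q (w t)` in `Fin L → K`
  (clauses (W) and (X) of the route verbatim).
* `capacityTransfer_bookkeeping` — real-exponent bookkeeping, UNIFORM in the word length `L ≥ 1`:
  with `ε = δ/16` and `m` large (depending on `δ, n₀` only), a code of size `N ≥ (m^L)^{1/2-ε}` and a
  host prime `p ≤ 2·3^L·m^L` leave room for `n := max n₀ ⌈p^{1/(2+δ)}⌉₊` pairs: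
  `n₀ ≤ n ≤ N`, `p ≤ n^{2+δ}`, `n^{2-δ} ≤ (m^{1-ε})^L`.
* `stub_capacityTransfer` — the registered stub: reindex `W` by `Fin |W|`, lift, transfer into a prime
  host by the tree's `Theorems.exists_prime_sdpp_of_addEquiv` (`k = L` cyclic factors `ℤ/m`,
  `AddEquiv.refl`), keep the first `n` blocks.

Helper file landed `--supports stmt-MatrixMultiplication-14308`; the statement is the registered stub
signature verbatim (gadget / SDPP clauses inlined, no new definitions).
-/

-- single-conjunct summit: the mandated namespace repeats `MatrixMultiplication`.
set_option linter.dupNamespace false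

namespace Summit.MatrixMultiplication.MatrixMultiplication.Theorems.PrimeTwoFamilies.CapacityLift

open Finset
open Summit.MatrixMultiplication.MatrixMultiplication.Theses
open Summit.MatrixMultiplication.MatrixMultiplication.Theorems
open Summit.MatrixMultiplication.MatrixMultiplication.Theorems.PrimeTwoFamilies.Negative
open Literature.Computability.AlgebraicComplexity

/-! ## The code lift -/

/-- **Code lift.**  Let `(P c, Q c)_{c<r}` be a gadget of DIRECT pairs in an abelian group `K`
(`(x - x') + (y - y') = 0` with `x, x' ∈ P c`, `y, y' ∈ Q c` forces `x = x'`, `y = y'`) and let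
`W` be a set of words `Fin L → Fin r` in which every ordered pair of distinct words `i ≠ k` is
STRONGLY SEPARATED in some coordinate `t` (the cross differences `Q (k t) - P (i t)` avoid every
diagonal difference set `Q c - P c`).  Then the product blocks `A w := ∏ₜ P (w t)`,
`B w := ∏ₜ Q (w t)` (`w ∈ W`) satisfy the two SDPP clauses of the route: (W) every block pair is
direct (coordinatewise), and (X) `(a - a') + (b - b') = 0` with `a ∈ A i`, `a' ∈ A j`, `b ∈ B j`,
`b' ∈ B k` forces `i = k` (at the separating coordinate `t` of `i ≠ k` the identity reads
`b' t - a t = b t - a' t`, a cross difference equal to a diagonal one). -/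
theorem capacityTransfer_codeLift {K : Type*} [AddCommGroup K] [DecidableEq K] {r L : ℕ}
    (P Q : Fin r → Finset K)
    (hD : ∀ c : Fin r, ∀ x ∈ P c, ∀ x' ∈ P c, ∀ y ∈ Q c, ∀ y' ∈ Q c,
      (x - x') + (y - y') = 0 → x = x' ∧ y = y')
    (W : Finset (Fin L → Fin r))
    (hW : ∀ i ∈ W, ∀ k ∈ W, i ≠ k → ∃ t : Fin L,
      ∀ x ∈ P (i t), ∀ y ∈ Q (k t), ∀ c : Fin r, ∀ x' ∈ P c, ∀ y' ∈ Q c, y - x ≠ y' - x') :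
    (∀ w ∈ W, ∀ a ∈ Fintype.piFinset (fun t => P (w t)), ∀ a' ∈ Fintype.piFinset (fun t => P (w t)),
      ∀ b ∈ Fintype.piFinset (fun t => Q (w t)), ∀ b' ∈ Fintype.piFinset (fun t => Q (w t)),
        (a - a') + (b - b') = 0 → a = a' ∧ b = b') ∧
    (∀ i ∈ W, ∀ j ∈ W, ∀ k ∈ W,
      ∀ a ∈ Fintype.piFinset (fun t => P (i t)), ∀ a' ∈ Fintype.piFinset (fun t => P (j t)),
      ∀ b ∈ Fintype.piFinset (fun t => Q (j t)), ∀ b' ∈ Fintype.piFinset (fun t => Q (k t)),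
        (a - a') + (b - b') = 0 → i = k) := by
  -- adapted from `codeLift` (Cruxes/PrimeTwoFamilies/Lines/Sketch.lean, ideator 6), hypotheses inlined
  refine ⟨?_, ?_⟩
  · intro w _ a ha a' ha' b hb b' hb' h
    rw [Fintype.mem_piFinset] at ha ha' hb hb'
    have key : ∀ t, a t = a' t ∧ b t = b' t := fun t =>
      hD (w t) (a t) (ha t) (a' t) (ha' t) (b t) (hb t) (b' t) (hb' t)
        (by have := congrFun h t; simpa using this)
    exact ⟨funext fun t => (key t).1, funext fun t => (key t).2⟩
  · intro i hi j _ k hk a ha a' ha' b hb b' hb' h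
    rw [Fintype.mem_piFinset] at ha ha' hb hb'
    by_contra hik
    obtain ⟨t, ht⟩ := hW i hi k hk hik
    have key : (a t - a' t) + (b t - b' t) = 0 := by
      have := congrFun h t; simpa using this
    have e : b' t - a t = b t - a' t := by
      have h2 : (a t - a' t) + (b t - b' t) = (b t - a' t) - (b' t - a t) := by abel
      rw [h2] at key
      exact (sub_eq_zero.1 key).symm
    exact ht (a t) (ha t) (b' t) (hb' t) (j t) (a' t) (ha' t) (b t) (hb t) e

/-! ## Exponent bookkeeping (uniform in the word length) -/

/-- A constant is eventually dominated by a positive real power: if `0 ≤ K` and `0 < g` then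
`K ≤ M ^ g` for every real `M ≥ ⌈K ^ (1/g)⌉₊`. -/
theorem capacityTransfer_dominates (K g : ℝ) (hK : 0 ≤ K) (hg : 0 < g) :
    ∃ m₀ : ℕ, ∀ M : ℝ, (m₀ : ℝ) ≤ M → K ≤ M ^ g := by
  refine ⟨⌈K ^ g⁻¹⌉₊, fun M hM => ?_⟩
  have hKM : K ^ g⁻¹ ≤ M := (Nat.le_ceil _).trans hM
  calc K = (K ^ g⁻¹) ^ g := (Real.rpow_inv_rpow hK hg.ne').symm
    _ ≤ M ^ g := Real.rpow_le_rpow (Real.rpow_nonneg hK _) hKM hg.le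

/-- **Bookkeeping, uniform in `L`.**  For `0 < δ ≤ 1` and every `n₀` there is a threshold `m₀`
(depending on `δ, n₀` only) such that for every level `m ≥ m₀`, every word length `L ≥ 1`, every
code size `N ≥ (m^L)^{1/2-δ/16}` and every host size `p ≤ 2·3^L·m^L` there is a number `n` of pairs
with `n₀ ≤ n ≤ N`, `p ≤ n^{2+δ}` and `n^{2-δ} ≤ (m^{1-δ/16})^L`.  Choice:
`n := max n₀ ⌈p^{1/(2+δ)}⌉₊`; with `M := m^L ≥ m` one has `2·3^L ≤ 6^L ≤ M^{δ/16}` once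
`6 ≤ m^{δ/16}`, so `p ≤ M^{1+δ/16}` and `n ≤ 2 M^{(1+δ/16)/(2+δ)} ≤ M^{1/2-δ/16}` for `M` large by
the exponent gap `(1+δ/16)/(2+δ) < 1/2 - δ/16` (`δ < 5`); finally
`n^{2-δ} ≤ M^{(1/2-δ/16)(2-δ)} ≤ M^{1-δ/16}`. -/
theorem capacityTransfer_bookkeeping {δ : ℝ} (hδ : 0 < δ) (hδ1 : δ ≤ 1) (n₀ : ℕ) :
    ∃ m₀ : ℕ, ∀ m : ℕ, m₀ ≤ m → ∀ L : ℕ, 1 ≤ L →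
      ∀ N : ℕ, ((m : ℝ) ^ (L : ℝ)) ^ (1 / 2 - δ / 16) ≤ (N : ℝ) →
      ∀ p : ℕ, p ≤ 2 * (3 ^ L * m ^ L) →
        ∃ n : ℕ, n₀ ≤ n ∧ n ≤ N ∧ (p : ℝ) ≤ (n : ℝ) ^ (2 + δ) ∧
          (n : ℝ) ^ (2 - δ) ≤ ((m : ℝ) ^ (1 - δ / 16)) ^ L := by
  have h2δ : (0 : ℝ) < 2 + δ := by linarith
  -- the exponent gap behind `n ≤ N`, and the exponent inequality behind the co-volume bound
  have hg₁ : 0 < 1 / 2 - δ / 16 - (1 + δ / 16) / (2 + δ) := by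
    rw [sub_pos, div_lt_iff₀ h2δ]
    nlinarith
  have hexp₂ : (1 / 2 - δ / 16) * (2 - δ) ≤ 1 - δ / 16 := by nlinarith
  -- thresholds
  obtain ⟨m₁, hm₁⟩ := capacityTransfer_dominates 6 (δ / 16) (by norm_num) (by positivity)
  obtain ⟨m₂, hm₂⟩ :=
    capacityTransfer_dominates (n₀ : ℝ) (1 / 2 - δ / 16) (Nat.cast_nonneg _) (by linarith)
  obtain ⟨m₃, hm₃⟩ := capacityTransfer_dominates 2 _ zero_le_two hg₁
  refine ⟨max 1 (max m₁ (max m₂ m₃)), fun m hm L hL N hN p hp => ?_⟩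
  have hm1 : 1 ≤ m := le_trans (le_max_left _ _) hm
  have hmm₁ : m₁ ≤ m := le_trans (le_trans (le_max_left _ _) (le_max_right _ _)) hm
  have hmm₂ : m₂ ≤ m :=
    le_trans (le_trans (le_trans (le_max_left _ _) (le_max_right _ _)) (le_max_right _ _)) hm
  have hmm₃ : m₃ ≤ m :=
    le_trans (le_trans (le_trans (le_max_right _ _) (le_max_right _ _)) (le_max_right _ _)) hm
  have hm1R : (1 : ℝ) ≤ m := by exact_mod_cast hm1
  have hm0R : (0 : ℝ) ≤ m := zero_le_one.trans hm1R
  -- the real size `M = m ^ L ≥ m` of the lifted host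
  set M : ℝ := (m : ℝ) ^ L with hM
  have hmM : (m : ℝ) ≤ M := le_self_pow₀ hm1R (by omega)
  have hM1 : 1 ≤ M := hm1R.trans hmM
  have hM0 : 0 < M := one_pos.trans_le hM1
  have hNM : M ^ (1 / 2 - δ / 16) ≤ N := by rwa [Real.rpow_natCast] at hN
  -- `p ≤ M ^ (1 + δ/16)`
  have hpM : (p : ℝ) ≤ M ^ (1 + δ / 16) := by
    have h1 : (p : ℝ) ≤ 2 * (3 ^ L * (m : ℝ) ^ L) := by exact_mod_cast hp
    have h2 : (2 : ℝ) * 3 ^ L ≤ 6 ^ L := by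
      have h22 : (2 : ℝ) ≤ 2 ^ L := by
        calc (2 : ℝ) = 2 ^ 1 := (pow_one _).symm
          _ ≤ 2 ^ L := pow_le_pow_right₀ one_le_two hL
      calc (2 : ℝ) * 3 ^ L ≤ 2 ^ L * 3 ^ L := mul_le_mul_of_nonneg_right h22 (by positivity)
        _ = 6 ^ L := by rw [← mul_pow]; norm_num
    have h3 : (6 : ℝ) ^ L ≤ M ^ (δ / 16) := by
      calc (6 : ℝ) ^ L ≤ ((m : ℝ) ^ (δ / 16)) ^ L :=
            pow_le_pow_left₀ (by norm_num) (hm₁ m (by exact_mod_cast hmm₁)) L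
        _ = M ^ (δ / 16) := by
            rw [hM, ← Real.rpow_mul_natCast hm0R, mul_comm, Real.rpow_natCast_mul hm0R]
    calc (p : ℝ) ≤ 2 * 3 ^ L * M := by rw [mul_assoc]; exact h1
      _ ≤ M ^ (δ / 16) * M := mul_le_mul_of_nonneg_right (h2.trans h3) hM0.le
      _ = M ^ (1 + δ / 16) := by rw [add_comm, Real.rpow_add_one hM0.ne']
  -- hence `p ^ (1/(2+δ)) ≤ M ^ ((1 + δ/16)/(2+δ))`
  have hroot : (p : ℝ) ^ (2 + δ)⁻¹ ≤ M ^ ((1 + δ / 16) / (2 + δ)) := by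
    calc (p : ℝ) ^ (2 + δ)⁻¹ ≤ (M ^ (1 + δ / 16)) ^ (2 + δ)⁻¹ :=
          Real.rpow_le_rpow (Nat.cast_nonneg _) hpM (inv_nonneg.2 h2δ.le)
      _ = M ^ ((1 + δ / 16) / (2 + δ)) := by rw [← Real.rpow_mul hM0.le, ← div_eq_mul_inv]
  -- the number of pairs kept
  set n₁ : ℕ := ⌈(p : ℝ) ^ (2 + δ)⁻¹⌉₊ with hn₁
  have hnM : ((max n₀ n₁ : ℕ) : ℝ) ≤ M ^ (1 / 2 - δ / 16) := by
    rw [Nat.cast_max]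
    refine max_le (hm₂ M ((show (m₂ : ℝ) ≤ m by exact_mod_cast hmm₂).trans hmM)) ?_
    have h1 : (n₁ : ℝ) < (p : ℝ) ^ (2 + δ)⁻¹ + 1 :=
      Nat.ceil_lt_add_one (Real.rpow_nonneg (Nat.cast_nonneg _) _)
    have h2 : (1 : ℝ) ≤ M ^ ((1 + δ / 16) / (2 + δ)) := Real.one_le_rpow hM1 (by positivity)
    have h3 : (2 : ℝ) ≤ M ^ (1 / 2 - δ / 16 - (1 + δ / 16) / (2 + δ)) :=
      hm₃ M ((show (m₃ : ℝ) ≤ m by exact_mod_cast hmm₃).trans hmM)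
    calc (n₁ : ℝ) ≤ 2 * M ^ ((1 + δ / 16) / (2 + δ)) := by linarith
      _ ≤ M ^ (1 / 2 - δ / 16 - (1 + δ / 16) / (2 + δ)) * M ^ ((1 + δ / 16) / (2 + δ)) :=
          mul_le_mul_of_nonneg_right h3 (by positivity)
      _ = M ^ (1 / 2 - δ / 16) := by rw [← Real.rpow_add hM0, sub_add_cancel]
  refine ⟨max n₀ n₁, le_max_left _ _, ?_, ?_, ?_⟩
  · -- `n ≤ N`
    exact_mod_cast hnM.trans hNM
  · -- `p ≤ n ^ (2+δ)`
    have hXn : (p : ℝ) ^ (2 + δ)⁻¹ ≤ ((max n₀ n₁ : ℕ) : ℝ) :=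
      (Nat.le_ceil _).trans (by exact_mod_cast le_max_right n₀ n₁)
    calc (p : ℝ) = ((p : ℝ) ^ (2 + δ)⁻¹) ^ (2 + δ) :=
          (Real.rpow_inv_rpow (Nat.cast_nonneg _) h2δ.ne').symm
      _ ≤ ((max n₀ n₁ : ℕ) : ℝ) ^ (2 + δ) :=
          Real.rpow_le_rpow (Real.rpow_nonneg (Nat.cast_nonneg _) _) hXn h2δ.le
  · -- `n ^ (2-δ) ≤ (m ^ (1-δ/16)) ^ L`
    calc ((max n₀ n₁ : ℕ) : ℝ) ^ (2 - δ) ≤ (M ^ (1 / 2 - δ / 16)) ^ (2 - δ) :=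
          Real.rpow_le_rpow (Nat.cast_nonneg _) hnM (by linarith)
      _ = M ^ ((1 / 2 - δ / 16) * (2 - δ)) := (Real.rpow_mul hM0.le _ _).symm
      _ ≤ M ^ (1 - δ / 16) := Real.rpow_le_rpow_of_exponent_le hM1 hexp₂
      _ = ((m : ℝ) ^ (1 - δ / 16)) ^ L := by
          rw [hM, ← Real.rpow_natCast_mul hm0R, mul_comm, Real.rpow_mul_natCast hm0R]

/-! ## The registered stub -/

/-- **Stub `stub_capacityTransfer`: capacity gadgets give every slice `0 < δ ≤ 1` of the crux.**
If for every `ε > 0` there are arbitrarily large `m`, a gadget of direct pairs `(P c, Q c)` in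
`ℤ/m` of co-volume `|P c||Q c| ≥ m^{1-ε}`, and a zero-error code `W` of words `Fin L → Fin r`
(`L ≥ 1`, every ordered pair of distinct words strongly separated in some coordinate) of size
`|W| ≥ (m^L)^{1/2-ε}`, then `PrimeTwoFamiliesAt δ`: arbitrarily large `n`, a prime `p ≤ n^{2+δ}` and
`n` SDPP pairs in `ℤ/p` with `|A i||B i| ≥ n^{2-δ}`.  Proof: take `ε := δ/16` and a level
`m ≥ max m₀ 1` with `m₀` from `capacityTransfer_bookkeeping`; enumerate `W` by `Fin |W|`
(`Finset.equivFin`) and lift (`capacityTransfer_codeLift`) to `|W|` SDPP blocks in `Fin L → ℤ/m` of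
co-volume `∏ₜ |P (w t)||Q (w t)| ≥ (m^{1-ε})^L`; move them into a prime `p ≤ 2·3^L·m^L` with sizes kept
by the carry-free transfer `Theorems.exists_prime_sdpp_of_addEquiv` (`k = L` factors `ℤ/m`,
`AddEquiv.refl`); keep the first `n` blocks (`Fin.castLE`), `n` from the bookkeeping. -/
theorem stub_capacityTransfer
    (h : ∀ ε : ℝ, 0 < ε → ∀ m₀ : ℕ, ∃ m ≥ m₀, ∃ r L : ℕ, ∃ P Q : Fin r → Finset (ZMod m),
      ∃ W : Finset (Fin L → Fin r),
        (∀ c : Fin r, ∀ x ∈ P c, ∀ x' ∈ P c, ∀ y ∈ Q c, ∀ y' ∈ Q c,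
            (x - x') + (y - y') = 0 → x = x' ∧ y = y') ∧
        (∀ i ∈ W, ∀ k ∈ W, i ≠ k → ∃ t : Fin L,
            ∀ x ∈ P (i t), ∀ y ∈ Q (k t), ∀ c : Fin r, ∀ x' ∈ P c, ∀ y' ∈ Q c, y - x ≠ y' - x') ∧
        1 ≤ L ∧ ((m : ℝ) ^ (L : ℝ)) ^ (1 / 2 - ε) ≤ (W.card : ℝ) ∧
        ∀ c : Fin r, (m : ℝ) ^ (1 - ε) ≤ (((P c).card * (Q c).card : ℕ) : ℝ))
    {δ : ℝ} (hδ : 0 < δ) (hδ1 : δ ≤ 1) : PrimeTwoFamiliesAt δ := by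
  classical
  intro n₀
  obtain ⟨m₀, hm₀⟩ := capacityTransfer_bookkeeping hδ hδ1 n₀
  obtain ⟨m, hm, r, L, P, Q, W, hD, hC, hL, hWcard, hPQ⟩ := h (δ / 16) (by positivity) (max m₀ 1)
  have hm₀m : m₀ ≤ m := le_trans (le_max_left _ _) hm
  have hm1 : 1 ≤ m := le_trans (le_max_right _ _) hm
  -- the code and its enumeration
  set N : ℕ := W.card with hN
  let e : W ≃ Fin N := W.equivFin
  -- the lifted family, indexed by `Fin N`
  let A : Fin N → Finset (Fin L → ZMod m) :=
    fun i => Fintype.piFinset (fun t => P ((e.symm i : Fin L → Fin r) t))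
  let B : Fin N → Finset (Fin L → ZMod m) :=
    fun i => Fintype.piFinset (fun t => Q ((e.symm i : Fin L → Fin r) t))
  obtain ⟨hW1, hX1⟩ := capacityTransfer_codeLift P Q hD W hC
  have hWA : ∀ i : Fin N, ∀ a ∈ A i, ∀ a' ∈ A i, ∀ b ∈ B i, ∀ b' ∈ B i,
      (a - a') + (b - b') = 0 → a = a' ∧ b = b' :=
    fun i => hW1 _ (e.symm i).2
  have hXA : ∀ i j k : Fin N, ∀ a ∈ A i, ∀ a' ∈ A j, ∀ b ∈ B j, ∀ b' ∈ B k,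
      (a - a') + (b - b') = 0 → i = k := by
    intro i j k a ha a' ha' b hb b' hb' h0
    have hik := hX1 _ (e.symm i).2 _ (e.symm j).2 _ (e.symm k).2 a ha a' ha' b hb b' hb' h0
    exact e.symm.injective (Subtype.ext hik)
  -- transfer into a prime cyclic host (tree: route support CyclicReduction, transfer step)
  obtain ⟨p, hp, hpR, A', B', hcard, hW', hX'⟩ :=
    exists_prime_sdpp_of_addEquiv hWA hXA (m := fun _ : Fin L => m) (fun _ => hm1)
      (AddEquiv.refl (Fin L → ZMod m))
  rw [Fin.prod_const] at hpR
  -- the number of pairs kept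
  obtain ⟨n, hn₀, hnN, hpn, hnP⟩ := hm₀ m hm₀m L hL N hWcard p hpR
  refine ⟨n, hn₀, p, hp, A' ∘ Fin.castLE hnN, B' ∘ Fin.castLE hnN, ?_, ?_, hpn, ?_⟩
  · intro i
    exact hW' (Fin.castLE hnN i)
  · intro i j k a ha a' ha' b hb b' hb' h0
    exact Fin.castLE_injective hnN (hX' _ _ _ a ha a' ha' b hb b' hb' h0)
  · intro i
    have hci := hcard (Fin.castLE hnN i)
    simp only [Function.comp_apply]
    rw [hci.1, hci.2]
    simp only [A, B, Fintype.card_piFinset]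
    rw [← Finset.prod_mul_distrib]
    refine hnP.trans ?_
    rw [← Fin.prod_const]
    push_cast
    refine Finset.prod_le_prod (fun t _ => by positivity) fun t _ => ?_
    exact_mod_cast hPQ _

end Summit.MatrixMultiplication.MatrixMultiplication.Theorems.PrimeTwoFamilies.CapacityLift
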